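/- Copyright: the b2b-balaban cell (near-miss cell 7), T⁴-continuum fan-out, lineage t4-ne7b-p1 (node U5c COUNT
member).  Released under the licence of the surrounding project. -/
import Summits.QuantumFields.BalabanUV.T4Continuum.Support.HistoryBankingFlatJunction

/-!
# M5-2d (A3d), file 1∕2 — THE JOINS WITHIN THE LAG: the component count drops only at joins, and a join is charged to a
birth below it (owner module of row NE7b, lineage `t4-ne7b-p1` gen 50; re-open object (α), ruling R-OWNER-49-2 (3)
«G-M5-2 … repair = (α)-M5-2d», `SPEC-M5-2d-SHRUNK-IMAGE-LEDGER.v0.md`; PRE-POSITIONING ONLY)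

Summits-side support leaf of the T⁴-continuum cell (rung (B)+1 on a FINITE torus only; NOT infinite volume, NOT the
mass gap, NOT the Clay statement; NOT a proof of the spine estimate NE7b — the cell's OWN estimate, NOT PRINTED, NOT
PROVED).  [folklore] finite combinatorics and real arithmetic over `HistoryAdmissible.PGen` (`Adm`, `rootStep`,
`lastStep`), A3b `HistoryBankingPedigreeLedger.compSum` and M5-1b's `HistoryBankingBirthBookings.{bfee, blin}`; nothing
printed is asserted, no cite-tagged hypothesis, no `def … : Prop`, zero `sorry`.  Two `def`s (`nj`, `jfee`: a recursive
finite count ∕ sum over the pedigree — the join analogues of M5-1b's `nb` ∕ `bfee`).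

WHY (the sibling `HistoryBankingShrunkLedger`, M5-2d file 2∕2).  M5-1b's flat ledger charges the collar of the components
alive at the lag time `m − j` at the paying step `m` through the growth display, which puts the growth letter `L_u` (and,
through the births' fee, the lag `j`) into the per-level floor exchange `huΦ` — the located volume debt G-M5-2.  The
repair counts the components AT THE PAYING LEVEL: between `m − j` and `m` the count drops only at the joins within the
lag (§1 `compSum_one_lag_le`: `N(m−j) ≤ N(m) + nj j P m`), each join is within the lag for `j` steps
(`sum_nj_le_jfee`), and the joins' weighted fee is below `Γ` times the births' (`jfee_le_bfee`: a binary pedigree has fewer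
joins than births, each join after the root step of its later-rooted partner — the root-step potential `jfee_add_le`),
hence below `Γ·blin` (`bfee_le_blin`): the joins go to the births' class-linear content, not to the floors.

HONEST: the lineage's own bookkeeping; NE7b NOT proved; spine 0∕9.  HONEST DEPENDENCY (cell): continuum YM on T⁴ ⇐
BetaPertH ∧ nine spine estimates (0∕9 proved); BetaPertH ⇐ (D1) ∧ (D4) ∧ CAP+tail.  This file changes none of it.
-/

open Finset
open Literature.MathematicalPhysics.QuantumFieldTheory.Balaban1983to89
open Literature.MathematicalPhysics.QuantumFieldTheory.Balaban1983to89.B13ScaleTransfer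
open Literature.MathematicalPhysics.QuantumFieldTheory.Balaban1983to89.B16SProfile
open Literature.MathematicalPhysics.QuantumFieldTheory.Balaban1983to89.B16StoppingRule
open T4PersistenceDictionary T4PrintedShapeBanking T4TaggedShapeBanking T4BankedInduction T4BranchingRecordsGas
open Summit.QuantumFields.BalabanUV.T4Continuum.HistoryAdmissible
open Summit.QuantumFields.BalabanUV.T4Continuum.HistoryRealise
open Summit.QuantumFields.BalabanUV.T4Continuum.HistoryRealiseWeak
open Summit.QuantumFields.BalabanUV.T4Continuum.HistoryBankingPedigreeMax
open Summit.QuantumFields.BalabanUV.T4Continuum.HistoryBankingPedigreeLedger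
open Summit.QuantumFields.BalabanUV.T4Continuum.HistoryBankingFloors
open Summit.QuantumFields.BalabanUV.T4Continuum.HistoryBankingBirthBookings
open Summit.QuantumFields.BalabanUV.T4Continuum.HistoryBankingFlatLedger
open Summit.QuantumFields.BalabanUV.T4Continuum.HistoryBankingFlatJunction

namespace Summit.QuantumFields.BalabanUV.T4Continuum.HistoryBankingJoinLag

noncomputable section

open scoped Classical

variable {d : ℕ} {γ : Type*}

/-! ## §1 The joins within the lag, and their exchange against the births -/

section Joins

variable (j : ℕ)

/-- **THE JOINS WITHIN THE LAG**: the number of joins `J` of the pedigree with `s_J ≤ m < s_J + j`. [folklore] -/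
def nj : PGen γ → ℕ → ℕ
  | .birth _ _ _, _ => 0
  | .renew G _, m => nj G m
  | .join X Y sJ, m => nj X m + nj Y m + (if sJ ≤ m ∧ m < sJ + j then 1 else 0)

/-- **THE JOINS' FEE, WEIGHTED**: `Σ_J u_{s_J}` over the joins of the pedigree. [folklore] -/
def jfee (u : ℕ → ℝ) : PGen γ → ℝ
  | .birth _ _ _ => 0
  | .renew G _ => jfee u G
  | .join X Y sJ => jfee u X + jfee u Y + u sJ

variable {j}

/-- the joins' fee is nonnegative for `u ≥ 0` [folklore] -/
theorem jfee_nonneg {u : ℕ → ℝ} (hu : ∀ n, 0 ≤ u n) : ∀ P : PGen γ, 0 ≤ jfee u P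
  | .birth _ _ _ => le_rfl
  | .renew G _ => jfee_nonneg hu G
  | .join X Y sJ => add_nonneg (add_nonneg (jfee_nonneg hu X) (jfee_nonneg hu Y)) (hu sJ)

/-- the birth fee is below the class-linear content (`u ≥ 0`, classes `≥ 0`) [folklore] -/
theorem bfee_le_blin {u : ℕ → ℝ} (hu : ∀ n, 0 ≤ u n) : ∀ P : PGen γ, bfee u P ≤ blin u P
  | .birth jb cls _ => by
      change u jb ≤ u jb * ((cls : ℝ) + 1)
      have h1 : (1 : ℝ) ≤ (cls : ℝ) + 1 := by have := Nat.cast_nonneg (α := ℝ) cls; linarith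
      nlinarith [hu jb]
  | .renew G _ => bfee_le_blin hu G
  | .join X Y _ => add_le_add (bfee_le_blin hu X) (bfee_le_blin hu Y)

variable {L : ℕ} {s : ℕ → ℕ}

/-- **THE COMPONENT COUNT DROPS ONLY AT JOINS**: for an admissible pedigree and `j ≤ m`,
`compSum 1 P (m − j) ≤ compSum 1 P m + nj j P m` — a component at `m − j` is a component at `m` unless a join within the
lag merged it. [folklore] -/
theorem compSum_one_lag_le {K m : ℕ} (hjm : j ≤ m) :
    ∀ P : PGen (Pt d × Finset (Pt d)), P.Adm K →
      compSum L s (fun _ => (1 : ℝ)) P (m - j) ≤ compSum L s (fun _ => (1 : ℝ)) P m + (nj j P m : ℝ)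
  | .birth jb cls zZ, _ => by
      unfold compSum nj
      by_cases h1 : jb ≤ m - j
      · rw [if_pos h1, if_pos (by omega)]; simp
      · rw [if_neg h1]; split_ifs <;> simp
  | .renew G h, hA => by
      simp only [PGen.Adm] at hA
      unfold compSum nj
      exact compSum_one_lag_le hjm G hA.1
  | .join X Y sJ, hA => by
      simp only [PGen.Adm] at hA
      obtain ⟨hAX, hAY, hXs, hYs, -⟩ := hA
      have ihX := compSum_one_lag_le hjm X hAX
      have ihY := compSum_one_lag_le hjm Y hAY
      have hnjX : (0 : ℝ) ≤ (nj j X m : ℝ) := Nat.cast_nonneg _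
      have hnjY : (0 : ℝ) ≤ (nj j Y m : ℝ) := Nat.cast_nonneg _
      have hNX := compSum_nonneg (L := L) (s := s) (fun _ => zero_le_one) X (m - j)
      have hNY := compSum_nonneg (L := L) (s := s) (fun _ => zero_le_one) Y (m - j)
      have hcast : (nj j (PGen.join X Y sJ) m : ℝ) =
          (nj j X m : ℝ) + (nj j Y m : ℝ) + (if sJ ≤ m ∧ m < sJ + j then (1 : ℝ) else 0) := by
        rw [show nj j (PGen.join X Y sJ) m = nj j X m + nj j Y m + (if sJ ≤ m ∧ m < sJ + j then 1 else 0) from rfl]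
        push_cast; split_ifs <;> simp
      rw [hcast]
      by_cases hst : sJ ≤ m - j
      · -- one component at both times
        have e1 : compSum L s (fun _ => (1 : ℝ)) (PGen.join X Y sJ) (m - j) = 1 := by
          unfold compSum; rw [if_pos hst]
        have e2 : compSum L s (fun _ => (1 : ℝ)) (PGen.join X Y sJ) m = 1 := by
          unfold compSum; rw [if_pos (by omega)]
        rw [e1, e2]
        split_ifs <;> linarith
      · have e1 : compSum L s (fun _ => (1 : ℝ)) (PGen.join X Y sJ) (m - j) =
            compSum L s (fun _ => (1 : ℝ)) X (m - j) + compSum L s (fun _ => (1 : ℝ)) Y (m - j) := by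
          conv_lhs => unfold compSum
          rw [if_neg hst]
        rw [e1]
        by_cases hsm : sJ ≤ m
        · -- the join is within the lag: the partners were one component each at `m`
          have e2 : compSum L s (fun _ => (1 : ℝ)) (PGen.join X Y sJ) m = 1 := by
            unfold compSum; rw [if_pos hsm]
          have eX : compSum L s (fun _ => (1 : ℝ)) X m = 1 := compSum_of_le X hAX (by omega)
          have eY : compSum L s (fun _ => (1 : ℝ)) Y m = 1 := compSum_of_le Y hAY (by omega)
          rw [e2, if_pos ⟨hsm, by omega⟩]
          rw [eX] at ihX; rw [eY] at ihY
          linarith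
        · have e2 : compSum L s (fun _ => (1 : ℝ)) (PGen.join X Y sJ) m =
              compSum L s (fun _ => (1 : ℝ)) X m + compSum L s (fun _ => (1 : ℝ)) Y m := by
            conv_lhs => unfold compSum
            rw [if_neg hsm]
          rw [e2, if_neg (fun h => hsm h.1)]
          linarith

/-- each join is within the lag for `j` steps: `Σ_{m≤K} u_m·nj j P m ≤ j·Γ·jfee u P` under the growth display
[folklore] -/
theorem sum_nj_le_jfee {K : ℕ} {u : ℕ → ℝ} (hu : ∀ n, 0 ≤ u n) {Γ : ℝ}
    (hΓ : ∀ t i, i < j → u (t + i) ≤ Γ * u t) :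
    ∀ P : PGen (Pt d × Finset (Pt d)), ∑ m ∈ Finset.range (K + 1), u m * (nj j P m : ℝ) ≤ j * Γ * jfee u P
  | .birth jb cls zZ => by
      have e1 : ∀ m, (nj j (PGen.birth jb cls zZ) m : ℝ) = 0 := fun m => by unfold nj; simp
      simp only [e1, mul_zero, Finset.sum_const_zero]
      unfold jfee; simp
  | .renew G h => by
      have ih := sum_nj_le_jfee (K := K) hu hΓ G
      have e1 : ∀ m, (nj j (PGen.renew G h) m : ℝ) = nj j G m := fun m => rfl
      simp only [e1]; exact ih
  | .join X Y sJ => by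
      have ihX := sum_nj_le_jfee (K := K) hu hΓ X
      have ihY := sum_nj_le_jfee (K := K) hu hΓ Y
      have e1 : ∀ m, u m * (nj j (PGen.join X Y sJ) m : ℝ) = u m * (nj j X m : ℝ) + u m * (nj j Y m : ℝ)
          + u m * (if sJ ≤ m ∧ m < sJ + j then (1 : ℝ) else 0) := fun m => by
        rw [show nj j (PGen.join X Y sJ) m = nj j X m + nj j Y m + (if sJ ≤ m ∧ m < sJ + j then 1 else 0) from rfl]
        push_cast; split_ifs <;> ring
      simp only [e1, Finset.sum_add_distrib]
      -- the join at `sJ` is within the lag exactly at the steps `sJ ≤ m < sJ + j`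
      have hterm : ∀ m ∈ Finset.range (K + 1), u m * (if sJ ≤ m ∧ m < sJ + j then (1 : ℝ) else 0) ≤
          if m ∈ Finset.Ico sJ (sJ + j) then u m else 0 := by
        intro m _
        by_cases hm : sJ ≤ m ∧ m < sJ + j
        · rw [if_pos hm, if_pos (by rw [Finset.mem_Ico]; omega)]; simp
        · rw [if_neg hm, if_neg (by rw [Finset.mem_Ico]; omega)]; simp
      have hJ : ∑ m ∈ Finset.range (K + 1), u m * (if sJ ≤ m ∧ m < sJ + j then (1 : ℝ) else 0) ≤ j * Γ * u sJ := by
        refine (Finset.sum_le_sum hterm).trans ?_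
        rw [← Finset.sum_filter]
        calc ∑ m ∈ (Finset.range (K + 1)).filter (fun m => m ∈ Finset.Ico sJ (sJ + j)), u m
            ≤ ∑ m ∈ Finset.Ico sJ (sJ + j), u m :=
              Finset.sum_le_sum_of_subset_of_nonneg (fun m hm => (Finset.mem_filter.1 hm).2) fun m _ _ => hu m
          _ = ∑ i ∈ Finset.range j, u (sJ + i) := by rw [Finset.sum_Ico_eq_sum_range, Nat.add_sub_cancel_left]
          _ ≤ ∑ i ∈ Finset.range j, Γ * u sJ := Finset.sum_le_sum fun i hi => hΓ sJ i (Finset.mem_range.1 hi)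
          _ = j * Γ * u sJ := by rw [Finset.sum_const, Finset.card_range, nsmul_eq_mul]; ring
      change _ ≤ j * Γ * (jfee u X + jfee u Y + u sJ)
      linarith

/-- **A JOIN IS CHARGED TO A BIRTH BELOW IT** (the root-step potential): for an admissible pedigree (`Adm K`), weights
`u ≥ 0` with the cumulative growth `u_n ≤ Γ·u_t` for `t ≤ n ≤ K` and `Γ ≥ 0`,
`jfee u P + Γ·u_{rootStep P} ≤ Γ·bfee u P` — each join step is after the root step of its later-rooted partner.
[folklore] -/
theorem jfee_add_le {K : ℕ} {u : ℕ → ℝ} {Γ : ℝ}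
    (hΓ : ∀ t n, t ≤ n → n ≤ K → u n ≤ Γ * u t) :
    ∀ P : PGen γ, P.Adm K → jfee u P + Γ * u P.rootStep ≤ Γ * bfee u P
  | .birth jb cls z, _ => by unfold jfee bfee; simp [PGen.rootStep]
  | .renew G h, hA => by
      simp only [PGen.Adm] at hA
      unfold jfee bfee; simp only [PGen.rootStep]
      exact jfee_add_le hΓ G hA.1
  | .join X Y sJ, hA => by
      simp only [PGen.Adm] at hA
      obtain ⟨hAX, hAY, hXs, hYs, hsK⟩ := hA
      have ihX := jfee_add_le hΓ X hAX
      have ihY := jfee_add_le hΓ Y hAY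
      have hrX := PGen.Adm.rootStep_le_lastStep hAX
      have hrY := PGen.Adm.rootStep_le_lastStep hAY
      unfold jfee bfee; simp only [PGen.rootStep]
      by_cases hle : X.rootStep ≤ Y.rootStep
      · rw [min_eq_left hle]
        have hs : u sJ ≤ Γ * u Y.rootStep := hΓ _ _ (by omega) hsK
        linarith
      · rw [min_eq_right (le_of_lt (not_le.1 hle))]
        have hs : u sJ ≤ Γ * u X.rootStep := hΓ _ _ (by omega) hsK
        linarith

/-- **THE JOINS' FEE IS BELOW `Γ` TIMES THE BIRTHS' FEE** (a binary pedigree has fewer joins than births, each join later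
than a birth it is charged to). [folklore] -/
theorem jfee_le_bfee {K : ℕ} {u : ℕ → ℝ} (hu : ∀ n, 0 ≤ u n) {Γ : ℝ} (hΓ0 : 0 ≤ Γ)
    (hΓ : ∀ t n, t ≤ n → n ≤ K → u n ≤ Γ * u t) (P : PGen γ) (hA : P.Adm K) :
    jfee u P ≤ Γ * bfee u P := by
  have h := jfee_add_le hΓ P hA
  nlinarith [hu P.rootStep]

end Joins

end

end Summit.QuantumFields.BalabanUV.T4Continuum.HistoryBankingJoinLag
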